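import Literature.Analysis.FluidPDE.OseenMildWindowRepresentative
import Literature.Analysis.FluidPDE.LocalTypeILiouville
import Literature.Analysis.FluidPDE.SuitableWeakRescaling
import HarnessLib

/-!
# Type-I-rate suitable weak solutions with `𝐈 < ∞` are continuous ancient Oseen-mild fields

Analysis/FluidPDE proof file (theorems only; no definitions, no named facts).

**Main result** (`exists_oseenMild_repr_of_typeIBound_lt_top`): let `(u, p)` be a suitable weak
solution of the unforced Navier–Stokes system (`ν = 1`) on the backward slab `(−∞, 0) × ℝ³` with the
Type-I rate `‖u(t, x)‖ ≤ C/√(−t)` (`HasTypeITimeDecay C u`, KNSS 2009 (1.4)) and Albritton–Barker's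
quantity `𝐈 = 𝐈(ℝ³ × ℝ₋) < ∞` (`typeIBound`, any weak gradient `G`). Then `u` is almost everywhere
equal on the slab to a field `v` which is continuous on the open slab, has weakly divergence-free
slices at every negative time, solves the Oseen integral equation
`v(t) = e^{(t−s)Δ}v(s) − B¹ₛ(v, v)(t)` pointwise for all `s < t < 0` (a bounded mild solution on every
`(−∞, −δ)`, KNSS 2009, §4 (i), Remark 4.1), and keeps the rate `‖v(t, x)‖ ≤ C/√(−t)` everywhere.

This is the slab form of the forward direction of Albritton–Barker 2019, Thm. 1.1 ("there exists a
suitable weak solution with Type I singular point ⟹ there exists a mild bounded ancient solution with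
`𝐈 < ∞`"; A–B §3 via Seregin–Šverák 2009, Thm. 2.8), for a solution already living on the whole
backward slab: no blow-up procedure is needed, the mildness being obtained directly from KNSS's
Lemma 3.1 and the vanishing of the parasitic drift under the `A`-part of `𝐈`
(`ae_energy_ball_le_typeIBound`: `∫_{B_m(0)} ‖u(t)‖² ≤ 𝐈 m` at a.e. `t ∈ (−m², 0)`).

**Proof.** On each window `W_n = (−(n+2), −1/(n+2))` the rate bounds `u` by `C √(n+2)`, and
`exists_oseenMild_repr_window` (`OseenMildWindowRepresentative.lean`) gives a continuous Oseen-mild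
representative `v_n = u` a.e. on `W_n × ℝ³`; two representatives agree on the overlap of their windows
(continuous and a.e. equal on an open set, `Measure.eqOn_open_of_ae_eq`), so `v(t) = v_{n(t)}(t)` with
`t ∈ W_{n(t)}` is well defined, locally equal to some `v_n`, and inherits everything; the rate passes
from `u` (a.e.) to the continuous `v` (everywhere) by the same principle.

## References

* D. Albritton, T. Barker, *On local Type I singularities of the Navier–Stokes equations and
  Liouville theorems*, J. Math. Fluid Mech. 21 (2019) = arXiv:1811.00502, Thm. 1.1, §3.
  [AlbrittonBarker2019]
* G. Koch, N. Nadirashvili, G. Seregin, V. Šverák, Acta Math. 203 (2009) = arXiv:0709.3599, (1.4),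
  Lemma 3.1, §4 (i), Remark 4.1. [KochNadirashviliSereginSverak2009, KNSS2009]
* G. Seregin, V. Šverák, Comm. PDE 34 (2009) = arXiv:0804.1803, Thm. 2.8. [SereginSverak2009]
-/

noncomputable section

open MeasureTheory Set Function Filter Metric TopologicalSpace
open _root_.Topology
open scoped NNReal ENNReal RealInnerProductSpace

namespace Literature.Analysis.FluidPDE

/-- Local notation for physical space `ℝ³ = EuclideanSpace ℝ (Fin 3)`. -/
local notation "ℝ³" => EuclideanSpace ℝ (Fin 3)

variable {u : ℝ → ℝ³ → ℝ³} {p : ℝ → ℝ³ → ℝ} {G : ℝ → ℝ³ → ℝ³ →L[ℝ] ℝ³} {C : ℝ}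

/-- **Albritton–Barker's `𝐈 < ∞` gives the Morrey bound at the origin at a.e. time**: if
`𝐈(ℝ³ × ℝ₋) = I < ∞` then for every `m > 0`, `∫_{B_m(0)} ‖u(t)‖² ≤ I m` for a.e. `t ∈ (−m², 0)`
(`A(Q((0,0), m)) ≤ 𝐈`, essential supremum in time). [cite: AlbrittonBarker2019, §1 (definition of 𝐈) and §3] -/
theorem ae_lintegral_ball_sq_le_of_typeIBound {I : ℝ}
    (hI : typeIBound (Iio (0 : ℝ) ×ˢ (univ : Set ℝ³)) u p G ≤ ENNReal.ofReal I) {m : ℝ} (hm : 0 < m) :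
    ∀ᵐ t ∂(volume.restrict (Ioo (-m ^ 2) (0 : ℝ))),
      ∫⁻ y in ball (0 : ℝ³) m, ‖u t y‖ₑ ^ 2 ≤ ENNReal.ofReal (I * m) := by
  filter_upwards [ae_energy_ball_le_typeIBound (u := u) (p := p) (G := G) hm] with t ht
  have ht' := ht.trans hI
  have hm0 : ENNReal.ofReal m ≠ 0 := by simpa using hm
  calc ∫⁻ y in ball (0 : ℝ³) m, ‖u t y‖ₑ ^ 2
      = ENNReal.ofReal m * ((ENNReal.ofReal m)⁻¹ * ∫⁻ y in ball (0 : ℝ³) m, ‖u t y‖ₑ ^ 2) := by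
        rw [← mul_assoc, ENNReal.mul_inv_cancel hm0 ENNReal.ofReal_ne_top, one_mul]
    _ ≤ ENNReal.ofReal m * ENNReal.ofReal I := mul_le_mul_right ht' _
    _ = ENNReal.ofReal (I * m) := by rw [← ENNReal.ofReal_mul hm.le, mul_comm]

/-- **Type-I-rate suitable weak solutions with `𝐈 < ∞` are continuous ancient Oseen-mild fields**
(the slab form of the forward direction of Albritton–Barker 2019, Thm. 1.1; module docstring). For
`(u, p)` suitable weak (`ν = 1`, no force) on `(−∞, 0) × ℝ³` with `‖u(t, x)‖ ≤ C/√(−t)` and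
`𝐈(ℝ³ × ℝ₋) < ∞`, there is `v : ℝ → ℝ³ → ℝ³` with `u = v` a.e. on the slab, `v` continuous on the
open slab, weakly divergence-free slices at every `t < 0`,
`v(t, x) = e^{(t−s)Δ}v(s)(x) − B¹ₛ(v, v)(t)(x)` for all `s < t < 0` and all `x`, and
`‖v(t, x)‖ ≤ C/√(−t)` for all `t < 0` and all `x`.
[cite: AlbrittonBarker2019, Thm 1.1 (forward direction, §3), with KochNadirashviliSereginSverak2009, Lemma 3.1, §4 (i) and proof of Thm 6.1 (arXiv pp. 7–8, 12)] -/
theorem exists_oseenMild_repr_of_typeIBound_lt_top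
    (hsw : IsSuitableWeakSolutionOn (slab ℝ³ (Iio 0) isOpen_Iio) 1 0 u p)
    (hC : HasTypeITimeDecay C u)
    (hI : typeIBound (Iio (0 : ℝ) ×ˢ (univ : Set ℝ³)) u p G < ∞) :
    ∃ v : ℝ → ℝ³ → ℝ³,
      (∀ᵐ w ∂(volume.restrict (Iio (0 : ℝ) ×ˢ (univ : Set ℝ³))), uncurry u w = uncurry v w) ∧
      ContinuousOn (uncurry v) (Iio 0 ×ˢ univ) ∧
      (∀ t < 0, IsWeaklyDivFree (v t)) ∧
      (∀ s t : ℝ, s < t → t < 0 → ∀ x,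
        v t x = UnboundedOperators.heatExtension (v s) (t - s) x - oseenDuhamel 1 s v v t x) ∧
      HasTypeITimeDecay C v := by
  -- ## constants
  have hC0 : 0 ≤ C := by
    have h := hC (-1) (by norm_num) 0
    rw [neg_neg, Real.sqrt_one, div_one] at h
    exact (norm_nonneg _).trans h
  set I : ℝ := (typeIBound (Iio (0 : ℝ) ×ˢ (univ : Set ℝ³)) u p G).toReal with hIdef
  have hI0 : 0 ≤ I := ENNReal.toReal_nonneg
  have hIle : typeIBound (Iio (0 : ℝ) ×ˢ (univ : Set ℝ³)) u p G ≤ ENNReal.ofReal I :=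
    (ENNReal.ofReal_toReal hI.ne).symm.le
  -- ## the windows `W n = (−(n+2), −1/(n+2))`
  set a : ℕ → ℝ := fun n => -((n : ℝ) + 2) with ha
  set c : ℕ → ℝ := fun n => -(1 / ((n : ℝ) + 2)) with hc
  have hc0 : ∀ n, c n < 0 := fun n => by rw [hc]; dsimp only; rw [neg_lt_zero]; positivity
  have hac : ∀ n, a n < c n := fun n => by
    rw [ha, hc]; dsimp only
    have hn : (2 : ℝ) ≤ (n : ℝ) + 2 := by linarith [(Nat.cast_nonneg n : (0 : ℝ) ≤ n)]
    have h1 : 1 / ((n : ℝ) + 2) ≤ 1 / 2 := div_le_div_of_nonneg_left zero_le_one two_pos hn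
    linarith
  have hanti : ∀ {k m : ℕ}, k ≤ m → a m ≤ a k := fun {k m} hkm => by
    rw [ha]; dsimp only
    have : (k : ℝ) ≤ m := by exact_mod_cast hkm
    linarith
  have hcmono : ∀ {k m : ℕ}, k ≤ m → c k ≤ c m := fun {k m} hkm => by
    rw [hc]; dsimp only
    have : (k : ℝ) ≤ m := by exact_mod_cast hkm
    have h1 : 1 / ((m : ℝ) + 2) ≤ 1 / ((k : ℝ) + 2) :=
      div_le_div_of_nonneg_left zero_le_one (by positivity) (by linarith)
    linarith
  have hnest : ∀ {k m : ℕ}, k ≤ m → Ioo (a k) (c k) ⊆ Ioo (a m) (c m) := fun hkm t ht =>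
    ⟨(hanti hkm).trans_lt ht.1, ht.2.trans_le (hcmono hkm)⟩
  -- suitable weak, bounded, and Morrey on each window
  have hswn : ∀ n, IsSuitableWeakSolutionOn (slab ℝ³ (Ioo (a n) (c n)) isOpen_Ioo) 1 0 u p :=
    fun n => hsw.of_le (slab_mono fun t ht => ht.2.trans (hc0 n))
  have hMn : ∀ n, ∀ t ∈ Ioo (a n) (c n), ∀ x, ‖u t x‖ ≤ C / Real.sqrt (1 / ((n : ℝ) + 2)) := by
    intro n t ht x
    refine (hC t (ht.2.trans (hc0 n)) x).trans
      (div_le_div_of_nonneg_left hC0 (Real.sqrt_pos.2 (by positivity)) (Real.sqrt_le_sqrt ?_))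
    have h2 : t < -(1 / ((n : ℝ) + 2)) := ht.2
    linarith
  have hMorn : ∀ n, ∀ᵐ t ∂(volume.restrict (Ioo (a n) (c n))), ∀ m : ℕ, n + 2 ≤ m →
      ∫⁻ y in ball (0 : ℝ³) m, ‖u t y‖ₑ ^ 2 ≤ ENNReal.ofReal (I * m) := by
    intro n
    rw [ae_all_iff]
    intro m
    by_cases hm : n + 2 ≤ m
    · have hmpos : 0 < (m : ℝ) := by exact_mod_cast (show 0 < m by omega)
      have hm2 : (n : ℝ) + 2 ≤ m := by exact_mod_cast hm
      have hsub : Ioo (a n) (c n) ⊆ Ioo (-(m : ℝ) ^ 2) 0 := fun t ht =>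
        ⟨lt_of_le_of_lt (by rw [ha] at ht; nlinarith) ht.1, ht.2.trans (hc0 n)⟩
      exact (ae_restrict_of_ae_restrict_of_subset hsub
        (ae_lintegral_ball_sq_le_of_typeIBound hIle hmpos)).mono fun t ht _ => ht
    · exact Eventually.of_forall fun t h => absurd h hm
  -- ## the window representatives and their agreement on overlaps
  choose v hvc hvd hvm hvae using fun n =>
    exists_oseenMild_repr_window (hac n) (hswn n) (hMn n) hI0 (hMorn n)
  have hagree : ∀ k n, EqOn (uncurry (v k)) (uncurry (v n))
      ((Ioo (a k) (c k) ∩ Ioo (a n) (c n)) ×ˢ (univ : Set ℝ³)) := by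
    intro k n
    have hO : IsOpen ((Ioo (a k) (c k) ∩ Ioo (a n) (c n)) ×ˢ (univ : Set ℝ³)) :=
      (isOpen_Ioo.inter isOpen_Ioo).prod isOpen_univ
    refine Measure.eqOn_open_of_ae_eq (μ := (volume : Measure (ℝ × ℝ³))) ?_ hO
      ((hvc k).mono (prod_mono inter_subset_left Subset.rfl))
      ((hvc n).mono (prod_mono inter_subset_right Subset.rfl))
    have hs1 : (Ioo (a k) (c k) ∩ Ioo (a n) (c n)) ×ˢ (univ : Set ℝ³) ⊆ Ioo (a k) (c k) ×ˢ univ :=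
      prod_mono inter_subset_left Subset.rfl
    have hs2 : (Ioo (a k) (c k) ∩ Ioo (a n) (c n)) ×ˢ (univ : Set ℝ³) ⊆ Ioo (a n) (c n) ×ˢ univ :=
      prod_mono inter_subset_right Subset.rfl
    have h1 := ae_restrict_of_ae_restrict_of_subset hs1 (hvae k)
    have h2 := ae_restrict_of_ae_restrict_of_subset hs2 (hvae n)
    filter_upwards [h1, h2] with w hw1 hw2
    rw [← hw1, ← hw2]
  -- ## the index of a window containing a given negative time
  set idx : ℝ → ℕ := fun t => ⌈-t⌉₊ + ⌈1 / (-t)⌉₊ with hidxdef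
  have hidx : ∀ t < 0, t ∈ Ioo (a (idx t)) (c (idx t)) := by
    intro t ht
    have ht0 : 0 < -t := neg_pos.2 ht
    have h1 : -t ≤ (⌈-t⌉₊ : ℝ) := Nat.le_ceil _
    have h2 : 1 / (-t) ≤ (⌈1 / (-t)⌉₊ : ℝ) := Nat.le_ceil _
    have hk : ((idx t : ℕ) : ℝ) = (⌈-t⌉₊ : ℝ) + ⌈1 / (-t)⌉₊ := by
      rw [hidxdef]; dsimp only; rw [Nat.cast_add]
    have hn1 : (0 : ℝ) ≤ ⌈-t⌉₊ := Nat.cast_nonneg _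
    have hn2 : (0 : ℝ) ≤ ⌈1 / (-t)⌉₊ := Nat.cast_nonneg _
    constructor
    · show -(((idx t : ℕ) : ℝ) + 2) < t
      rw [hk]; linarith
    · show t < -(1 / (((idx t : ℕ) : ℝ) + 2))
      rw [hk]
      have hpos : (0 : ℝ) < (⌈-t⌉₊ : ℝ) + ⌈1 / (-t)⌉₊ + 2 := by positivity
      have hK : 1 / (-t) < (⌈-t⌉₊ : ℝ) + ⌈1 / (-t)⌉₊ + 2 := by linarith
      rw [div_lt_iff₀ ht0] at hK
      rw [lt_neg, div_lt_iff₀ hpos]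
      linarith
  -- ## the representative
  set w : ℝ → ℝ³ → ℝ³ := fun t x => v (idx t) t x with hwdef
  have hloc : ∀ n, ∀ t ∈ Ioo (a n) (c n), ∀ x, w t x = v n t x := fun n t ht x =>
    hagree (idx t) n (x := (t, x)) ⟨⟨hidx t (ht.2.trans (hc0 n)), ht⟩, mem_univ _⟩
  -- `u = w` a.e. on the slab
  have haew : ∀ᵐ z ∂(volume.restrict (Iio (0 : ℝ) ×ˢ (univ : Set ℝ³))), uncurry u z = uncurry w z := by
    have hcover : Iio (0 : ℝ) ×ˢ (univ : Set ℝ³) ⊆ ⋃ n, Ioo (a n) (c n) ×ˢ (univ : Set ℝ³) :=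
      fun z hz => mem_iUnion.2 ⟨idx z.1, hidx z.1 hz.1, mem_univ _⟩
    refine ae_restrict_of_ae_restrict_of_subset hcover ((ae_restrict_iUnion_iff _ _).2 fun n => ?_)
    filter_upwards [hvae n, ae_restrict_mem (measurableSet_Ioo.prod MeasurableSet.univ)]
      with z hz hzI
    rw [hz]
    exact (hloc n z.1 hzI.1 z.2).symm
  refine ⟨w, haew, ?_, fun t ht => hvd (idx t) t (hidx t ht), fun s t hst ht x => ?_, fun t ht x => ?_⟩
  · -- continuity on the open slab
    rintro ⟨t, x⟩ ⟨ht, -⟩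
    have hW : Ioo (a (idx t)) (c (idx t)) ×ˢ (univ : Set ℝ³) ∈ 𝓝 (t, x) :=
      (isOpen_Ioo.prod isOpen_univ).mem_nhds ⟨hidx t ht, mem_univ _⟩
    have heq : EqOn (uncurry w) (uncurry (v (idx t))) (Ioo (a (idx t)) (c (idx t)) ×ˢ univ) :=
      fun z hz => hloc (idx t) z.1 hz.1 z.2
    exact (((hvc (idx t)).congr heq).continuousAt hW).continuousWithinAt
  · -- the Oseen identity, inside one window containing `s` and `t`
    have hs : s < 0 := hst.trans ht
    set m : ℕ := max (idx s) (idx t) with hm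
    have hsW : s ∈ Ioo (a m) (c m) := hnest (le_max_left _ _) (hidx s hs)
    have htW : t ∈ Ioo (a m) (c m) := hnest (le_max_right _ _) (hidx t ht)
    have h1 := hvm m s t hsW.1 hst htW.2 x
    have e1 : w t x = v m t x := hloc m t htW x
    have e2 : w s = v m s := funext (hloc m s hsW)
    have e3 : oseenDuhamel 1 s w w t x = oseenDuhamel 1 s (v m) (v m) t x := by
      simp only [oseenDuhamel_apply]
      refine setIntegral_congr_fun measurableSet_Ioo fun σ hσ => ?_
      have hσW : σ ∈ Ioo (a m) (c m) := ⟨hsW.1.trans hσ.1, hσ.2.trans htW.2⟩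
      have e : w σ = v m σ := funext (hloc m σ hσW)
      rw [e]
    rw [e1, e2, e3]
    exact h1
  · -- the rate passes from `u` (a.e.) to the continuous `w` (everywhere)
    set g : ℝ × ℝ³ → ℝ := fun z => min (C / Real.sqrt (-z.1) - ‖w z.1 z.2‖) 0 with hg
    have hwc : ContinuousOn (uncurry w) (Iio 0 ×ˢ univ) := by
      rintro ⟨t', x'⟩ ⟨ht', -⟩
      have hW : Ioo (a (idx t')) (c (idx t')) ×ˢ (univ : Set ℝ³) ∈ 𝓝 (t', x') :=
        (isOpen_Ioo.prod isOpen_univ).mem_nhds ⟨hidx t' ht', mem_univ _⟩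
      have heq : EqOn (uncurry w) (uncurry (v (idx t'))) (Ioo (a (idx t')) (c (idx t')) ×ˢ univ) :=
        fun z hz => hloc (idx t') z.1 hz.1 z.2
      exact (((hvc (idx t')).congr heq).continuousAt hW).continuousWithinAt
    have hgc : ContinuousOn g (Iio 0 ×ˢ univ) := by
      have h1 : ContinuousOn (fun z : ℝ × ℝ³ => C / Real.sqrt (-z.1)) (Iio 0 ×ˢ univ) :=
        continuousOn_const.div
          (Real.continuous_sqrt.comp (continuous_neg.comp continuous_fst)).continuousOn
          fun z hz => (Real.sqrt_pos.2 (neg_pos.2 hz.1)).ne'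
      have h2 : ContinuousOn (fun z : ℝ × ℝ³ => C / Real.sqrt (-z.1) - ‖w z.1 z.2‖) (Iio 0 ×ˢ univ) :=
        h1.sub hwc.norm
      exact continuous_min.comp_continuousOn (h2.prodMk continuousOn_const)
    have hg0 : g =ᵐ[volume.restrict (Iio (0 : ℝ) ×ˢ (univ : Set ℝ³))] fun _ => 0 := by
      filter_upwards [haew, ae_restrict_mem (measurableSet_Iio.prod MeasurableSet.univ)] with z hz hzI
      have hb : ‖w z.1 z.2‖ ≤ C / Real.sqrt (-z.1) := by
        have e : w z.1 z.2 = u z.1 z.2 := (show uncurry u z = uncurry w z from hz).symm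
        rw [e]
        exact hC z.1 hzI.1 z.2
      show min (C / Real.sqrt (-z.1) - ‖w z.1 z.2‖) 0 = 0
      exact min_eq_right (sub_nonneg.2 hb)
    have hEq := Measure.eqOn_open_of_ae_eq hg0 (isOpen_Iio.prod isOpen_univ) hgc continuousOn_const
    have h := hEq (x := (t, x)) ⟨ht, mem_univ _⟩
    have h' : 0 ≤ C / Real.sqrt (-t) - ‖w t x‖ := min_eq_right_iff.1 h
    linarith

end Literature.Analysis.FluidPDE

end
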